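import Literature.Probability.LatticeModels.CoarseCellMixingDefectsClusters
import Literature.Probability.LatticeModels.CoarseCellMixingCounting
import HarnessLib

/-!
# Coarse-cell mixing with defects: the extent of a cluster shape

Companion ("theorems only", pure combinatorics) file of `CoarseCellMixingDefectsClusters.lean`.
An expansion around bad clusters weights the ring cells of a fattened cluster `K` by
`e^{κ · dist(x, ·)}`; this needs the EXTENT of a cluster shape in terms of its cardinality: every
cell of a cluster shape `K` for the seed `Sd` at linking range `ρ` is within coarse distance
`ρ (|K| - 1)` of a seed cell of `K` (`IsClusterShape.exists_seed_cdist_le`). The proof avoids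
paths: the generations `reach i` of the closure inside `K` (seed cells, then repeatedly the cells of
`K` linked to the previous generation) grow by at least one cell per step until they stabilise, so
they exhaust `K` after `|K| - 1` steps, and generation `i` is within `i` links of the seed. Also the index set `clusterShapes ρ U Sd` of a decomposition by the value
of the attached bad cluster (`badCluster_mem_clusterShapes`).

## References

* S. Friedli, Y. Velenik, *Statistical Mechanics of Lattice Systems* (CUP 2017), §3.7.2, §5.7.
-/

noncomputable section

namespace Literature.Probability.LatticeModels

section Reach

variable {α : Type*} [DecidableEq α] (adj : α → α → Prop) [DecidableRel adj] (K Sd : Finset α)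

/-- The generations of the closure of the seed inside `K`: `reach 0 = Sd ∩ K`, and `reach (i+1)`
adds the cells of `K` linked to a cell of `reach i`. [folklore] -/
def reach : ℕ → Finset α
  | 0 => Sd ∩ K
  | i + 1 => reach i ∪ K.filter fun c => ∃ k ∈ reach i, adj k c

variable {adj K Sd}

/-- Every generation lies in `K`. [folklore] -/
theorem reach_subset (i : ℕ) : reach adj K Sd i ⊆ K := by
  induction i with
  | zero => exact Finset.inter_subset_right
  | succ i ih =>
    intro c hc
    rcases Finset.mem_union.1 hc with h | h
    · exact ih h
    · exact (Finset.mem_filter.1 h).1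

/-- The generations increase. [folklore] -/
theorem reach_mono_succ (i : ℕ) : reach adj K Sd i ⊆ reach adj K Sd (i + 1) :=
  Finset.subset_union_left

/-- The generations increase (general form). [folklore] -/
theorem reach_mono {i j : ℕ} (hij : i ≤ j) : reach adj K Sd i ⊆ reach adj K Sd j := by
  induction hij with
  | refl => exact Finset.Subset.refl _
  | step _ ih => exact ih.trans (reach_mono_succ _)

/-- Once a generation does not grow, it never grows again. [folklore] -/
theorem reach_eq_of_eq {i : ℕ} (h : reach adj K Sd (i + 1) = reach adj K Sd i) (j : ℕ) (hij : i ≤ j) :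
    reach adj K Sd j = reach adj K Sd i := by
  induction hij with
  | refl => rfl
  | step hle ih =>
    rename_i j
    show reach adj K Sd j ∪ _ = _
    rw [ih]
    exact h

/-- Either the generations have stabilised by step `i`, or generation `i` has at least
`|Sd ∩ K| + i` cells. [folklore] -/
theorem card_reach_or_stable (i : ℕ) :
    (∃ j < i, reach adj K Sd (j + 1) = reach adj K Sd j) ∨
      (Sd ∩ K).card + i ≤ (reach adj K Sd i).card := by
  induction i with
  | zero => exact Or.inr (by simp [reach])
  | succ i ih =>
    rcases ih with ⟨j, hj, hjeq⟩ | hcard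
    · exact Or.inl ⟨j, Nat.lt_succ_of_lt hj, hjeq⟩
    · by_cases heq : reach adj K Sd (i + 1) = reach adj K Sd i
      · exact Or.inl ⟨i, Nat.lt_succ_self i, heq⟩
      · right
        have hss : reach adj K Sd i ⊂ reach adj K Sd (i + 1) :=
          Finset.ssubset_iff_subset_ne.2 ⟨reach_mono_succ i, fun h => heq h.symm⟩
        have := Finset.card_lt_card hss
        omega

/-- **The generations exhaust the cluster shape**: if `K` is a cluster shape for `Sd` (its own
closure from the seed) with a seed cell, then `reach (|K| - 1) = K`. [folklore] -/
theorem reach_card_sub_one_eq (hK : IsClusterShape adj Sd K) (hne : (Sd ∩ K).Nonempty) :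
    reach adj K Sd (K.card - 1) = K := by
  set N := K.card - 1 with hN
  -- the generations have stabilised by step `N`
  have hstable : reach adj K Sd (N + 1) = reach adj K Sd N := by
    rcases card_reach_or_stable (adj := adj) (K := K) (Sd := Sd) (N + 1) with ⟨j, hj, hjeq⟩ | hcard
    · have h1 := reach_eq_of_eq hjeq (N + 1) (by omega)
      have h2 := reach_eq_of_eq hjeq N (by omega)
      rw [h1, h2]
    · exfalso
      have hle : (reach adj K Sd (N + 1)).card ≤ K.card := Finset.card_le_card (reach_subset _)
      have hpos : 0 < (Sd ∩ K).card := Finset.card_pos.2 hne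
      have hKpos : 0 < K.card := Finset.card_pos.2 (hne.mono Finset.inter_subset_right)
      omega
  -- a stable generation is closed under links inside `K`, hence contains the closure `K`
  refine Finset.Subset.antisymm (reach_subset N) ?_
  have hclosed : ∀ x ∈ reach adj K Sd N, ∀ y ∈ K, adj x y → y ∈ reach adj K Sd N := by
    intro x hx y hy hxy
    rw [← hstable]
    exact Finset.mem_union_right _ (Finset.mem_filter.2 ⟨hy, x, hx, hxy⟩)
  have hseed : ∀ s ∈ Sd, s ∈ K → s ∈ reach adj K Sd N := fun s hs hsK =>
    reach_mono (Nat.zero_le N) (show s ∈ reach adj K Sd 0 from Finset.mem_inter.2 ⟨hs, hsK⟩)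
  intro c hc
  have hc' : c ∈ seedClosure adj K Sd := by rw [hK]; exact hc
  exact seedClosure_induction (P := fun x => x ∈ reach adj K Sd N) hseed
    (fun x y hx hxy hy => hclosed x hx y hy hxy) hc'

end Reach

/-! ### The extent of a cluster shape on the coarse torus -/

section Extent

variable {d : ℕ} {μc : Fin d → ℕ}

/-- Generation `i` of the closure at linking range `ρ` is within coarse distance `ρ · i` of a seed
cell of `K`. [folklore] -/
theorem exists_seed_cdist_le_of_mem_reach {ρ : ℕ} {K Sd : Finset (CoarseIdx μc)} (i : ℕ)
    {c : CoarseIdx μc} (hc : c ∈ reach (fun x y : CoarseIdx μc => cdist x y ≤ ρ) K Sd i) :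
    ∃ s ∈ Sd, s ∈ K ∧ cdist s c ≤ ρ * i := by
  induction i generalizing c with
  | zero =>
    rw [reach, Finset.mem_inter] at hc
    exact ⟨c, hc.1, hc.2, by rw [cdist_self]; exact Nat.zero_le _⟩
  | succ i ih =>
    rcases Finset.mem_union.1 hc with h | h
    · obtain ⟨s, hs, hsK, hd⟩ := ih h
      exact ⟨s, hs, hsK, hd.trans (Nat.mul_le_mul_left ρ (Nat.le_succ i))⟩
    · obtain ⟨-, k, hk, hkc⟩ := Finset.mem_filter.1 h
      obtain ⟨s, hs, hsK, hd⟩ := ih hk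
      refine ⟨s, hs, hsK, ?_⟩
      calc cdist s c ≤ cdist s k + cdist k c := cdist_triangle _ _ _
        _ ≤ ρ * i + ρ := add_le_add hd hkc
        _ = ρ * (i + 1) := by ring

/-- **The extent of a cluster shape**: every cell of a cluster shape `K` for the seed `Sd` at
linking range `ρ` is within coarse distance `ρ (|K| - 1)` of a seed cell lying in `K`.
[folklore] -/
theorem IsClusterShape.exists_seed_cdist_le {ρ : ℕ} {K Sd : Finset (CoarseIdx μc)}
    (hK : IsClusterShape (fun x y : CoarseIdx μc => cdist x y ≤ ρ) Sd K) {c : CoarseIdx μc}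
    (hc : c ∈ K) : ∃ s ∈ Sd, s ∈ K ∧ cdist s c ≤ ρ * (K.card - 1) := by
  have hne : (Sd ∩ K).Nonempty := by
    obtain ⟨s, hs, hsK, -⟩ := hK.connected hc
    exact ⟨s, Finset.mem_inter.2 ⟨hs, hsK⟩⟩
  have hreach : c ∈ reach (fun x y : CoarseIdx μc => cdist x y ≤ ρ) K Sd (K.card - 1) := by
    rw [reach_card_sub_one_eq hK hne]; exact hc
  exact exists_seed_cdist_le_of_mem_reach _ hreach

/-- **Cells near a cluster shape are near the seed**: a cell within coarse distance `t` of a cell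
of a cluster shape `K` is within `t + ρ (|K| - 1)` of a seed cell of `K`. [folklore] -/
theorem IsClusterShape.exists_seed_cdist_le_of_near {ρ : ℕ} {K Sd : Finset (CoarseIdx μc)}
    (hK : IsClusterShape (fun x y : CoarseIdx μc => cdist x y ≤ ρ) Sd K) {c : CoarseIdx μc}
    {t : ℕ} (hc : ∃ k ∈ K, cdist k c ≤ t) : ∃ s ∈ Sd, s ∈ K ∧ cdist s c ≤ t + ρ * (K.card - 1) := by
  obtain ⟨k, hk, hkc⟩ := hc
  obtain ⟨s, hs, hsK, hsk⟩ := hK.exists_seed_cdist_le hk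
  refine ⟨s, hs, hsK, ?_⟩
  calc cdist s c ≤ cdist s k + cdist k c := cdist_triangle _ _ _
    _ ≤ ρ * (K.card - 1) + t := add_le_add hsk hkc
    _ = t + ρ * (K.card - 1) := add_comm _ _

end Extent

/-! ### The cluster shapes inside a universe -/

section Shapes

open scoped Classical

variable {d : ℕ} {μc : Fin d → ℕ} {V S : Type*}

/-- The cluster shapes (linking range `ρ`, seed `Sd`) inside the universe `U`: the index set of a
decomposition by the value of the attached bad cluster. [folklore] -/
def clusterShapes (ρ : ℕ) (U Sd : Finset (CoarseIdx μc)) : Finset (Finset (CoarseIdx μc)) :=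
  U.powerset.filter fun K => IsClusterShape (fun x y : CoarseIdx μc => cdist x y ≤ ρ) Sd K

/-- Membership in `clusterShapes`. [folklore] -/
theorem mem_clusterShapes {ρ : ℕ} {U Sd K : Finset (CoarseIdx μc)} :
    K ∈ clusterShapes ρ U Sd ↔ K ⊆ U ∧ IsClusterShape (fun x y : CoarseIdx μc => cdist x y ≤ ρ) Sd K := by
  rw [clusterShapes, Finset.mem_filter, Finset.mem_powerset]

/-- The bad cluster of every configuration is one of the cluster shapes inside `U`. [folklore] -/
theorem badCluster_mem_clusterShapes (good : CoarseIdx μc → Set (V → S)) (ρ : ℕ)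
    (U Sd : Finset (CoarseIdx μc)) (σ : V → S) :
    badCluster good ρ U Sd σ ∈ clusterShapes ρ U Sd :=
  mem_clusterShapes.2 ⟨(badCluster_subset good ρ U Sd σ).trans (Finset.filter_subset _ _),
    isClusterShape_badCluster good ρ U Sd σ⟩

end Shapes

end Literature.Probability.LatticeModels
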